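import Literature.AlgebraicGeometry.Resolution.FormalInverseFunction
import Literature.AlgebraicGeometry.Resolution.MvPowerSeriesChainRule
import Literature.AlgebraicGeometry.Resolution.PowerSeriesRegularLocal
import Literature.RingTheory.MvPowerSeries.MaximalIdealPow

/-!
# Milnor drop in characteristic two (`stub_muDropCharTwoOrdP`) — helper 1/8: Generic

Helper file for the stub `stub_muDropCharTwoOrdP` of crux `ClassicalRegimes`
(stmt-ResolutionOfSingularities-16884, route `WildCones`, line `milnor-descent`): the one-step drop
of the Milnor number `μ = dim_κ κ⟦u₁,…,uₙ⟧/(∂a)` of the cleaned state of `z² = a(u)` under the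
point-blow-up dynamics in characteristic two, `n ≥ 3`. The proof works on formal power series:
a hyperbolic pair `u_j u_l` of the quadratic part of `a` is split off by the formal coordinate change
`u_j ↦ q⁻¹ ∂_l a, u_l ↦ q⁻¹ ∂_j a` (formal inverse function theorem; `∂_j ∂_j = 0` in
characteristic two makes `∂_j ã ∈ (u_l)`, `∂_l ã ∈ (u_j)`), which commutes with the strict
transform; killing `u_j, u_l` descends to `n - 2` variables with the same Milnor algebras. The
leaves: `n ≥ 3` residual variables without hyperbolic pair are not isolated (Case A), `n = 1` is
`μ = ord - 1`, and `n = 2` is Max Noether's inequality `I(∂ₓa, ∂_y a) ≥ m m' + I(strict transforms)`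
at the point of the exceptional line plus the multiplicity `≤ 3` of that line in `(∂G)`.
Sources: G.-M. Greuel, G. Pfister, *The splitting lemma in any characteristic*, J. Algebra 689
(2026) = arXiv:2507.17078, Thm. 3.5 / Cor. 3.7 (the hyperbolic pair; only its linear part is used);
E. Casas-Alvero, *Singularities of Plane Curves*, §3 (Noether's formula); folklore otherwise.

This file: generic facts: colengths of ideals of `κ⟦X⟧` under algebra isomorphisms and surjections, non-finiteness of quotients by fewer than `n` non-units (Krull's height theorem), powers of the maximal ideal inside ideals of finite colength, and the characteristic-two identities `∂ₛ∂ₛ = 0`, `∂(X_t² g) = X_t² ∂g` for `Literature.AlgebraicGeometry.Resolution.MvPowerSeries.pderiv`.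
-/

noncomputable section

-- single-problem summit: the doubled namespace component `ResolutionOfSingularities` is forced
set_option linter.dupNamespace false

open scoped BigOperators Classical

open MvPowerSeries IsLocalRing

open Literature.AlgebraicGeometry.Resolution

namespace Summit.ResolutionOfSingularities.ResolutionOfSingularities.Theorems.WildCones

namespace MuDropCharTwoOrdP

variable {κ : Type} [Field κ]

/-! ## Colengths under isomorphisms and surjections -/

/-- A surjective algebra map whose kernel lies in `I` induces `A ⧸ I ≃ B ⧸ I.map K`. [folklore] -/
theorem exists_quot_equiv_of_surjective {A B : Type} [CommRing A] [CommRing B] [Algebra κ A]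
    [Algebra κ B] (K : A →ₐ[κ] B) (hK : Function.Surjective K) (I : Ideal A)
    (hI : RingHom.ker (K : A →+* B) ≤ I) :
    Nonempty ((A ⧸ I) ≃ₐ[κ] (B ⧸ I.map (K : A →+* B))) := by
  let φ : (A ⧸ I) →ₐ[κ] (B ⧸ I.map (K : A →+* B)) := Ideal.quotientMapₐ (I.map (K : A →+* B)) K
    Ideal.le_comap_map
  refine ⟨AlgEquiv.ofBijective φ ⟨?_, ?_⟩⟩
  · rw [injective_iff_map_eq_zero]
    intro x hx
    obtain ⟨a, rfl⟩ := Ideal.Quotient.mk_surjective x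
    have hx' : K a ∈ I.map (K : A →+* B) := by
      rw [← Ideal.Quotient.eq_zero_iff_mem]
      simpa [φ, Ideal.quotientMapₐ] using hx
    rw [Ideal.mem_map_iff_of_surjective (K : A →+* B) hK] at hx'
    obtain ⟨b, hb, hab⟩ := hx'
    rw [Ideal.Quotient.eq_zero_iff_mem]
    have : a - b ∈ RingHom.ker (K : A →+* B) := by
      rw [RingHom.mem_ker, map_sub]
      exact sub_eq_zero.mpr hab.symm
    simpa using I.add_mem (hI this) hb
  · intro y
    obtain ⟨b, rfl⟩ := Ideal.Quotient.mk_surjective y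
    obtain ⟨a, rfl⟩ := hK b
    exact ⟨Ideal.Quotient.mk I a, rfl⟩

/-- A larger ideal has a finite quotient if the smaller one has. [folklore] -/
theorem finite_quot_mono {A : Type} [CommRing A] [Algebra κ A] {I I' : Ideal A} (h : I ≤ I')
    (hI : Module.Finite κ (A ⧸ I)) : Module.Finite κ (A ⧸ I') :=
  Module.Finite.of_surjective (Ideal.Quotient.factorₐ κ h).toLinearMap
    (Ideal.Quotient.factor_surjective h)

/-! ## Power series rings: powers of the maximal ideal, Krull dimension -/

/-- An ideal of finite colength in `κ⟦X⟧` contains a power of the maximal ideal. [folklore] -/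
theorem exists_maximalIdeal_pow_le {n : ℕ} {I : Ideal (MvPowerSeries (Fin n) κ)}
    (hI : Module.Finite κ (MvPowerSeries (Fin n) κ ⧸ I)) (hI' : I ≠ ⊤) :
    ∃ r : ℕ, maximalIdeal (MvPowerSeries (Fin n) κ) ^ r ≤ I := by
  haveI : IsArtinianRing (MvPowerSeries (Fin n) κ ⧸ I) := IsArtinianRing.of_finite κ _
  obtain ⟨r, hr⟩ := IsArtinianRing.isNilpotent_jacobson_bot (R := MvPowerSeries (Fin n) κ ⧸ I)
  refine ⟨r, ?_⟩
  have hmap : (maximalIdeal (MvPowerSeries (Fin n) κ)).map (Ideal.Quotient.mk I) =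
      Ideal.jacobson (⊥ : Ideal (MvPowerSeries (Fin n) κ ⧸ I)) := by
    rw [← jacobson_eq_maximalIdeal I hI', Ideal.map_jacobson_of_surjective
      Ideal.Quotient.mk_surjective (by rw [Ideal.mk_ker]), Ideal.map_quotient_self]
  have h0 : ((maximalIdeal (MvPowerSeries (Fin n) κ)) ^ r).map (Ideal.Quotient.mk I) = ⊥ := by
    rw [Ideal.map_pow, hmap, hr, Ideal.zero_eq_bot]
  rwa [Ideal.map_eq_bot_iff_le_ker, Ideal.mk_ker] at h0

/-- A quotient of `κ⟦X₁,…,Xₙ⟧` by fewer than `n` non-units is not finite over `κ` (Krull's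
height theorem). [folklore] -/
theorem not_finite_quot_span {n : ℕ} (T : Finset (MvPowerSeries (Fin n) κ))
    (hT : (T : Set (MvPowerSeries (Fin n) κ)) ⊆ maximalIdeal (MvPowerSeries (Fin n) κ))
    (hcard : T.card < n) :
    ¬ Module.Finite κ (MvPowerSeries (Fin n) κ ⧸ Ideal.span (T : Set (MvPowerSeries (Fin n) κ))) := by
  intro hfin
  haveI : IsArtinianRing (MvPowerSeries (Fin n) κ ⧸ Ideal.span (T : Set (MvPowerSeries (Fin n) κ))) :=
    IsArtinianRing.of_finite κ _
  have h0 : Ring.KrullDimLE 0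
      (MvPowerSeries (Fin n) κ ⧸ Ideal.span (T : Set (MvPowerSeries (Fin n) κ))) :=
    (isArtinianRing_iff_isNoetherianRing_krullDimLE_zero.mp inferInstance).2
  rw [Ring.krullDimLE_iff] at h0
  have hjac : (T : Set (MvPowerSeries (Fin n) κ)) ⊆ Ring.jacobson (MvPowerSeries (Fin n) κ) := by
    rw [IsLocalRing.ringJacobson_eq_maximalIdeal]
    exact hT
  haveI := isRegularLocalRing_mvPowerSeries κ (Fin n)
  have hdim := ringKrullDim_le_ringKrullDim_quotient_add_card T hjac
  rw [ringKrullDim_mvPowerSeries, Nat.card_eq_fintype_card, Fintype.card_fin] at hdim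
  have h1 : ((n : ℕ) : WithBot ℕ∞) ≤ ((0 : ℕ) : WithBot ℕ∞) + ((T.card : ℕ) : WithBot ℕ∞) :=
    hdim.trans (add_le_add h0 le_rfl)
  have h2 : n ≤ 0 + T.card := by exact_mod_cast h1
  omega

/-- If `I` lies in an ideal spanned by fewer than `n` non-units then `κ⟦X₁,…,Xₙ⟧ ⧸ I` is not
finite over `κ`. [folklore] -/
theorem not_finite_quot_of_le_span {n : ℕ} {I : Ideal (MvPowerSeries (Fin n) κ)}
    (T : Finset (MvPowerSeries (Fin n) κ))
    (hT : (T : Set (MvPowerSeries (Fin n) κ)) ⊆ maximalIdeal (MvPowerSeries (Fin n) κ))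
    (hcard : T.card < n) (hI : I ≤ Ideal.span (T : Set (MvPowerSeries (Fin n) κ))) :
    ¬ Module.Finite κ (MvPowerSeries (Fin n) κ ⧸ I) :=
  fun h => not_finite_quot_span T hT hcard (finite_quot_mono hI h)

/-! ## Partial derivatives: coefficients, commutation, characteristic two -/

/-- The constant coefficient of `∂ₛ f` is the `Xₛ`-coefficient of `f`. [folklore] -/
theorem constantCoeff_pderiv {n : ℕ} (s : Fin n) (f : MvPowerSeries (Fin n) κ) :
    constantCoeff (MvPowerSeries.pderiv s f) = coeff (Finsupp.single s 1) f := by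
  rw [← coeff_zero_eq_constantCoeff_apply, MvPowerSeries.coeff_pderiv]
  simp

/-- The linear coefficients of `∂ₛ f`. [folklore] -/
theorem coeff_single_pderiv {n : ℕ} (s t : Fin n) (f : MvPowerSeries (Fin n) κ) :
    coeff (Finsupp.single t 1) (MvPowerSeries.pderiv s f) =
      (((Finsupp.single t 1 : Fin n →₀ ℕ) s : κ) + 1) *
        coeff (Finsupp.single t 1 + Finsupp.single s 1) f :=
  MvPowerSeries.coeff_pderiv s f _

/-- Partial derivatives commute. [folklore] -/
theorem pderiv_comm {n : ℕ} (s t : Fin n) (f : MvPowerSeries (Fin n) κ) :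
    MvPowerSeries.pderiv s (MvPowerSeries.pderiv t f) =
      MvPowerSeries.pderiv t (MvPowerSeries.pderiv s f) := by
  ext e
  simp only [MvPowerSeries.coeff_pderiv, Finsupp.add_apply, Finsupp.single_apply]
  rw [add_right_comm e]
  by_cases hst : s = t
  · subst hst; ring
  · rw [if_neg (Ne.symm hst), if_neg hst]
    push_cast
    ring

/-- In characteristic two, `∂ₛ ∂ₛ f = 0`. [folklore] -/
theorem pderiv_pderiv_self [CharP κ 2] {n : ℕ} (s : Fin n) (f : MvPowerSeries (Fin n) κ) :
    MvPowerSeries.pderiv s (MvPowerSeries.pderiv s f) = 0 := by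
  ext e
  simp only [MvPowerSeries.coeff_pderiv, Finsupp.add_apply, Finsupp.single_eq_same, map_zero]
  have h2 : ((e s : κ) + 1) * (((e s + 1 : ℕ) : κ) + 1) = 0 := by
    have : ((e s : κ) + 1) * (((e s + 1 : ℕ) : κ) + 1) = (((e s + 1) * (e s + 2) : ℕ) : κ) := by
      push_cast; ring
    rw [this, CharP.cast_eq_zero_iff κ 2]
    exact Nat.even_mul_succ_self (e s + 1) |>.two_dvd
  rw [← mul_assoc, h2, zero_mul]

/-- In characteristic two, `∂ₛ (X_t ^ 2 * g) = X_t ^ 2 * ∂ₛ g`. [folklore] -/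
theorem pderiv_X_sq_mul [CharP κ 2] {n : ℕ} (s t : Fin n) (g : MvPowerSeries (Fin n) κ) :
    MvPowerSeries.pderiv s (X t ^ 2 * g) = X t ^ 2 * MvPowerSeries.pderiv s g := by
  rw [Derivation.leibniz, Derivation.leibniz_pow, smul_eq_mul, smul_eq_mul]
  have h2 : (2 : MvPowerSeries (Fin n) κ) = 0 := by
    rw [← map_ofNat (C : κ →+* MvPowerSeries (Fin n) κ) 2, CharTwo.two_eq_zero, map_zero]
  simp [two_smul, ← two_mul, h2]

/-- A series supported on exponents all of whose entries are even has zero partial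
derivatives in characteristic two. [folklore] -/
theorem pderiv_eq_zero_of_even [CharP κ 2] {n : ℕ} (s : Fin n) (f : MvPowerSeries (Fin n) κ)
    (hf : ∀ A : Fin n →₀ ℕ, (¬ ∀ j, 2 ∣ A j) → coeff A f = 0) : MvPowerSeries.pderiv s f = 0 := by
  ext e
  rw [MvPowerSeries.coeff_pderiv, map_zero]
  by_cases h : ∀ j, 2 ∣ (e + Finsupp.single s 1 : Fin n →₀ ℕ) j
  · have hs := h s
    simp only [Finsupp.add_apply, Finsupp.single_eq_same] at hs
    have : ((e s : κ) + 1) = 0 := by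
      have : ((e s : κ) + 1) = ((e s + 1 : ℕ) : κ) := by push_cast; ring
      rw [this, CharP.cast_eq_zero_iff κ 2]
      exact hs
    rw [this, zero_mul]
  · rw [hf _ h, mul_zero]

end MuDropCharTwoOrdP

end Summit.ResolutionOfSingularities.ResolutionOfSingularities.Theorems.WildCones

end
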